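import Mathlib
import Summits.ValiantsHypothesis.ValiantsHypothesis.Theses.PartialSorting

/-!
# PartialSorting — `SmoothIsBoard`, part 1: producing the four Gasharov–Reiner patterns

Helper file for item stmt-ValiantsHypothesis-13597 (`SmoothIsBoard`, route PartialSorting).
The route decl phrases "`w` contains the pattern `p`" as
`∃ f : Fin k → Fin n, StrictMono f ∧ ∀ a b, (p a < p b ↔ w (f a) < w (f b))`.
Here we provide, for each of the four patterns `4231, 35142, 42513, 351624`, a lemma producing
such an `f` from explicit rows `r₁ < r₂ < ⋯` whose values under `w` are in the required relative
order, and the key combinatorial lemma (`pattern_of_essential`, Gasharov–Reiner 2002 Thm 4.2 /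
Sjöstrand 2007 Thm 3.1, "if" direction): if `(I, J)` is an essential square of `w`
(`w I < J ≤ w (I+1)`, a rook of `w` in column `J-1` weakly above row `I`, none in column `J`
weakly above row `I`) having a rook of `w` weakly north-east and a rook strictly south-west,
then `w` contains one of the four patterns.
-/

-- `Summit.ValiantsHypothesis.ValiantsHypothesis.…` is the tree's mandated single-conjunct layout
-- (Sub = Summit), so the duplicated namespace component is intended.
set_option linter.dupNamespace false

namespace Summit.ValiantsHypothesis.ValiantsHypothesis.Theorems.PartialSortingSmoothIsBoardPatterns

variable {n : ℕ}

/-- Rows `r₁ < r₂ < r₃ < r₄` with `w r₄ < w r₂ < w r₃ < w r₁` realise the pattern `4231`. -/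
theorem pattern4231_of_rows (w : Fin n → Fin n) (r₁ r₂ r₃ r₄ : Fin n)
    (h₁₂ : r₁ < r₂) (h₂₃ : r₂ < r₃) (h₃₄ : r₃ < r₄)
    (v₁ : w r₄ < w r₂) (v₂ : w r₂ < w r₃) (v₃ : w r₃ < w r₁) :
    ∃ f : Fin 4 → Fin n, StrictMono f ∧ ∀ a b : Fin 4,
      ((![3, 1, 2, 0] : Fin 4 → ℕ) a < (![3, 1, 2, 0] : Fin 4 → ℕ) b ↔ w (f a) < w (f b)) := by
  refine ⟨![r₁, r₂, r₃, r₄], ?_, ?_⟩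
  · refine Fin.strictMono_iff_lt_succ.mpr ?_
    intro i
    fin_cases i <;> simpa
  · intro a b
    fin_cases a <;> fin_cases b <;> simp <;> omega

/-- Rows `r₁ < ⋯ < r₅` with `w r₃ < w r₅ < w r₁ < w r₄ < w r₂` realise the pattern `35142`. -/
theorem pattern35142_of_rows (w : Fin n → Fin n) (r₁ r₂ r₃ r₄ r₅ : Fin n)
    (h₁₂ : r₁ < r₂) (h₂₃ : r₂ < r₃) (h₃₄ : r₃ < r₄) (h₄₅ : r₄ < r₅)
    (v₁ : w r₃ < w r₅) (v₂ : w r₅ < w r₁) (v₃ : w r₁ < w r₄) (v₄ : w r₄ < w r₂) :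
    ∃ f : Fin 5 → Fin n, StrictMono f ∧ ∀ a b : Fin 5,
      ((![2, 4, 0, 3, 1] : Fin 5 → ℕ) a < (![2, 4, 0, 3, 1] : Fin 5 → ℕ) b ↔ w (f a) < w (f b)) := by
  refine ⟨![r₁, r₂, r₃, r₄, r₅], ?_, ?_⟩
  · refine Fin.strictMono_iff_lt_succ.mpr ?_
    intro i
    fin_cases i <;> simpa
  · intro a b
    fin_cases a <;> fin_cases b <;> simp <;> omega

/-- Rows `r₁ < ⋯ < r₅` with `w r₄ < w r₂ < w r₅ < w r₁ < w r₃` realise the pattern `42513`. -/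
theorem pattern42513_of_rows (w : Fin n → Fin n) (r₁ r₂ r₃ r₄ r₅ : Fin n)
    (h₁₂ : r₁ < r₂) (h₂₃ : r₂ < r₃) (h₃₄ : r₃ < r₄) (h₄₅ : r₄ < r₅)
    (v₁ : w r₄ < w r₂) (v₂ : w r₂ < w r₅) (v₃ : w r₅ < w r₁) (v₄ : w r₁ < w r₃) :
    ∃ f : Fin 5 → Fin n, StrictMono f ∧ ∀ a b : Fin 5,
      ((![3, 1, 4, 0, 2] : Fin 5 → ℕ) a < (![3, 1, 4, 0, 2] : Fin 5 → ℕ) b ↔ w (f a) < w (f b)) := by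
  refine ⟨![r₁, r₂, r₃, r₄, r₅], ?_, ?_⟩
  · refine Fin.strictMono_iff_lt_succ.mpr ?_
    intro i
    fin_cases i <;> simpa
  · intro a b
    fin_cases a <;> fin_cases b <;> simp <;> omega

/-- Rows `r₁ < ⋯ < r₆` with `w r₃ < w r₅ < w r₁ < w r₆ < w r₂ < w r₄` realise `351624`. -/
theorem pattern351624_of_rows (w : Fin n → Fin n) (r₁ r₂ r₃ r₄ r₅ r₆ : Fin n)
    (h₁₂ : r₁ < r₂) (h₂₃ : r₂ < r₃) (h₃₄ : r₃ < r₄) (h₄₅ : r₄ < r₅) (h₅₆ : r₅ < r₆)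
    (v₁ : w r₃ < w r₅) (v₂ : w r₅ < w r₁) (v₃ : w r₁ < w r₆) (v₄ : w r₆ < w r₂)
    (v₅ : w r₂ < w r₄) :
    ∃ f : Fin 6 → Fin n, StrictMono f ∧ ∀ a b : Fin 6,
      ((![2, 4, 0, 5, 1, 3] : Fin 6 → ℕ) a < (![2, 4, 0, 5, 1, 3] : Fin 6 → ℕ) b ↔
        w (f a) < w (f b)) := by
  refine ⟨![r₁, r₂, r₃, r₄, r₅, r₆], ?_, ?_⟩
  · refine Fin.strictMono_iff_lt_succ.mpr ?_
    intro i
    fin_cases i <;> simpa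
  · intro a b
    fin_cases a <;> fin_cases b <;> simp <;> omega


/-- **Pattern extraction (Gasharov–Reiner 2002, proof of Thm 4.2; Sjöstrand 2007, proof of
Thm 3.1).** Let `w ∈ S_n` and let `(I, J)` be an *essential square* of `w` for the north-east
rank function: `w I < J ≤ w (I+1)`, the rook of `w` in column `J-1` lies weakly above row `I`
and the rook in column `J` lies strictly below row `I`.  If moreover `w` has a rook weakly
north-east of `(I, J)` (a row `i ≤ I` with `J ≤ w i`) and a rook in the opposite south-west
region (a row `i' > I` with `w i' < J`), then `w` contains one of the patterns
`4231, 35142, 42513, 351624` (in the encoding of the route decl `SmoothIsBoard`).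
The four cases are: whether some rook lies in rows `(i, I]` with value in `(w i', J)`, and
whether some rook lies in rows `(I, i')` with value in `[J, w i)`. -/
theorem pattern_of_essential (w : Equiv.Perm (Fin n)) (I I1 J J1 : Fin n)
    (hI1 : (I1 : ℕ) = I + 1) (hJ1 : (J : ℕ) = J1 + 1)
    (h1 : w I < J) (h2 : J ≤ w I1) (a₀ : Fin n) (ha₀ : a₀ ≤ I) (ha₀v : w a₀ = J1)
    (h4 : ∀ a, a ≤ I → w a ≠ J)
    (i : Fin n) (hi : i ≤ I) (hiv : J ≤ w i)
    (i' : Fin n) (hi' : I < i') (hi'v : w i' < J) :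
    (∃ f : Fin 4 → Fin n, StrictMono f ∧ ∀ a b : Fin 4,
      ((![3, 1, 2, 0] : Fin 4 → ℕ) a < (![3, 1, 2, 0] : Fin 4 → ℕ) b ↔ w (f a) < w (f b))) ∨
    (∃ f : Fin 5 → Fin n, StrictMono f ∧ ∀ a b : Fin 5,
      ((![2, 4, 0, 3, 1] : Fin 5 → ℕ) a < (![2, 4, 0, 3, 1] : Fin 5 → ℕ) b ↔ w (f a) < w (f b))) ∨
    (∃ f : Fin 5 → Fin n, StrictMono f ∧ ∀ a b : Fin 5,
      ((![3, 1, 4, 0, 2] : Fin 5 → ℕ) a < (![3, 1, 4, 0, 2] : Fin 5 → ℕ) b ↔ w (f a) < w (f b))) ∨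
    (∃ f : Fin 6 → Fin n, StrictMono f ∧ ∀ a b : Fin 6,
      ((![2, 4, 0, 5, 1, 3] : Fin 6 → ℕ) a < (![2, 4, 0, 5, 1, 3] : Fin 6 → ℕ) b ↔
        w (f a) < w (f b))) := by
  have hinj : ∀ {a b : Fin n}, w a = w b → a = b := fun h => w.injective h
  -- the rook of `w` in column `J` sits at a row `c₀ > I`
  obtain ⟨c₀, hc₀v⟩ : ∃ c₀, w c₀ = J := ⟨w.symm J, w.apply_symm_apply J⟩
  have hc₀ : I < c₀ := by
    by_contra h
    exact h4 c₀ (not_lt.mp h) hc₀v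
  -- elementary consequences of injectivity
  have d1 : i < I := by
    have : i ≠ I := fun h => by rw [h] at hiv; omega
    omega
  have d2 : J < w i := by
    have : w i ≠ w c₀ := fun h => by have := hinj h; omega
    omega
  have d3 : I1 < i' := by
    have : i' ≠ I1 := fun h => by rw [h] at hi'v; omega
    omega
  have d4 : w i' < J1 := by
    have : w i' ≠ w a₀ := fun h => by have := hinj h; omega
    omega
  have d5 : w i ≠ w I1 := fun h => by have := hinj h; omega
  have d6 : w I ≠ w i' := fun h => by have := hinj h; omega
  have d7 : c₀ ≠ i' := fun h => by rw [h] at hc₀v; omega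
  have d8 : a₀ ≠ i := fun h => by rw [h] at ha₀v; omega
  by_cases hTL : ∃ p, i < p ∧ p ≤ I ∧ w i' < w p ∧ w p < J
  · obtain ⟨p, hp1, hp2, hp3, hp4⟩ := hTL
    by_cases hBR : ∃ q, I < q ∧ q < i' ∧ J ≤ w q ∧ w q < w i
    · -- both: 4231 on rows i < p < q < i'
      obtain ⟨q, hq1, hq2, hq3, hq4⟩ := hBR
      exact Or.inl (pattern4231_of_rows w i p q i' hp1 (by omega) hq2 hp3 (by omega) hq4)
    · -- only the north-west rook: 42513 on rows i < p < I+1 < i' < c₀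
      push Not at hBR
      have e1 : w i < w I1 := by
        have := hBR I1 (by omega) d3 h2
        omega
      have e2 : i' < c₀ := by
        have : ¬ c₀ < i' := fun h => by have := hBR c₀ hc₀ h (by omega); omega
        omega
      exact Or.inr (Or.inr (Or.inl (pattern42513_of_rows w i p I1 i' c₀ hp1 (by omega) d3 e2
        hp3 (by omega) (by omega) e1)))
  · push Not at hTL
    have e1 : w I < w i' := by
      have : ¬ w i' < w I := fun h => by have := hTL I d1 le_rfl h; omega
      omega
    have e2 : a₀ < i := by
      have : ¬ i < a₀ := fun h => by have := hTL a₀ h ha₀ (by omega); omega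
      omega
    by_cases hBR : ∃ q, I < q ∧ q < i' ∧ J ≤ w q ∧ w q < w i
    · -- only the south-east rook: 35142 on rows a₀ < i < I < q < i'
      obtain ⟨q, hq1, hq2, hq3, hq4⟩ := hBR
      exact Or.inr (Or.inl (pattern35142_of_rows w a₀ i I q i' e2 d1 hq1 hq2 e1 (by omega)
        (by omega) hq4))
    · -- neither: 351624 on rows a₀ < i < I < I+1 < i' < c₀
      push Not at hBR
      have e3 : w i < w I1 := by
        have := hBR I1 (by omega) d3 h2
        omega
      have e4 : i' < c₀ := by
        have : ¬ c₀ < i' := fun h => by have := hBR c₀ hc₀ h (by omega); omega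
        omega
      exact Or.inr (Or.inr (Or.inr (pattern351624_of_rows w a₀ i I I1 i' c₀ e2 d1 (by omega) d3
        e4 e1 (by omega) (by omega) (by omega) e3)))

end Summit.ValiantsHypothesis.ValiantsHypothesis.Theorems.PartialSortingSmoothIsBoardPatterns
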